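import Mathlib.Analysis.SpecialFunctions.SmoothTransition
import Mathlib.MeasureTheory.Integral.IntervalIntegral.FundThmCalculus
import Mathlib.Topology.UniformSpace.HeineCantor
import HarnessLib

/-!
# Tracking a continuous force profile in `L¹` through a continuous surjection by a smooth path

Trunk T-ANALYSIS (Literature/Analysis/ODE). The elementary real-analysis lemma behind the
controllability of oscillator chains through NON-monotone interaction forces (Rey-Bellet–Thomas
2002, Prop. 4.2: "by H1 the map `∇U⁽²⁾` is onto"; Eckmann–Pillet–Rey-Bellet 1999 assume `∇U⁽²⁾`
a diffeomorphism and invert it along the prescribed force): a neighbour `q'` acts on an oscillator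
`q` only through the force `w(q - q')`, `w = -V'`; if `w : ℝ → ℝ` is merely CONTINUOUS and ONTO,
a prescribed continuous force profile `g` on `[0, T]` cannot in general be followed exactly by a
continuous relative position `y = q - q'` (no continuous selection of `w⁻¹`), but it can be
followed in `L¹([0, T])` — which is all the driven oscillator sees up to a uniformly small error —
by a SMOOTH path `y` with prescribed position and velocity at both ends:

* `smoothStep c δ` — the `C^∞` step `t ↦ smoothTransition((t - c)/δ)` (`0` on `t ≤ c`, `1` on
  `t ≥ c + δ`); `stairPath`, `trackPath` — the explicit smooth staircase through preimages
  `x_j ∈ w⁻¹(g(t_j))` on the pieces `[t_j + δ, t_{j+1}]`, glued to the affine germs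
  `a₀ + a₁ t` at `0` and `b₀ + b₁ (t - T)` at `T`;
* `exists_contDiff_forceTracking` — **for `w` continuous onto, `g` continuous on `[0, T]`,
  `T > 0`, `η > 0` and `a₀ a₁ b₀ b₁ ∈ ℝ` there is `y ∈ C²(ℝ)` with `y(0) = a₀`, `y'(0) = a₁`,
  `y(T) = b₀`, `y'(T) = b₁` and `∫₀ᵀ |w(y(t)) - g(t)| dt ≤ η`** (hence
  `|∫₀ᵗ (w∘y - g)| ≤ η` for all `t ∈ [0, T]`, `exists_contDiff_forceTracking'`): off the `J + 2`
  transition windows of total length `≤ (J + 4)δ` the error is the oscillation of `g` over one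
  piece, on them it is bounded by `sup_{[-R,R]} |w| + sup |g|` with `R` independent of `δ`.

## References

* L. Rey-Bellet, L. E. Thomas, Comm. Math. Phys. **225** (2002) 305–329, Prop. 4.2 (proof).
* J.-P. Eckmann, C.-A. Pillet, L. Rey-Bellet, Comm. Math. Phys. **201** (1999) 657–697, §3
  (controllability of the chain, Thm 3.2 of the JSP companion paper). [folklore]
-/

noncomputable section

open MeasureTheory Set Filter Topology intervalIntegral
open scoped NNReal

namespace Literature.Analysis.ODE

/-! ### Smooth steps -/

/-- The **smooth step** at `c` of width `δ`: `smoothTransition ((t - c)/δ)`, equal to `0` for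
`t ≤ c` and to `1` for `t ≥ c + δ` (`δ > 0`), with values in `[0, 1]`. [folklore] -/
def smoothStep (c δ t : ℝ) : ℝ :=
  Real.smoothTransition ((t - c) / δ)

/-- The smooth step vanishes left of `c`. [folklore] -/
theorem smoothStep_of_le {c δ t : ℝ} (hδ : 0 < δ) (h : t ≤ c) : smoothStep c δ t = 0 :=
  Real.smoothTransition.zero_of_nonpos (div_nonpos_of_nonpos_of_nonneg (sub_nonpos.2 h) hδ.le)

/-- The smooth step is `1` right of `c + δ`. [folklore] -/
theorem smoothStep_of_ge {c δ t : ℝ} (hδ : 0 < δ) (h : c + δ ≤ t) : smoothStep c δ t = 1 :=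
  Real.smoothTransition.one_of_one_le ((one_le_div hδ).2 (by linarith))

/-- The smooth step is nonnegative. [folklore] -/
theorem smoothStep_nonneg (c δ t : ℝ) : 0 ≤ smoothStep c δ t :=
  Real.smoothTransition.nonneg _

/-- The smooth step is at most `1`. [folklore] -/
theorem smoothStep_le_one (c δ t : ℝ) : smoothStep c δ t ≤ 1 :=
  Real.smoothTransition.le_one _

/-- `|step| ≤ 1`. [folklore] -/
theorem abs_smoothStep_le_one (c δ t : ℝ) : |smoothStep c δ t| ≤ 1 := by
  rw [abs_of_nonneg (smoothStep_nonneg c δ t)]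
  exact smoothStep_le_one c δ t

/-- `|1 - step| ≤ 1`. [folklore] -/
theorem abs_one_sub_smoothStep_le_one (c δ t : ℝ) : |1 - smoothStep c δ t| ≤ 1 := by
  rw [abs_of_nonneg (sub_nonneg.2 (smoothStep_le_one c δ t))]
  linarith [smoothStep_nonneg c δ t]

/-- The smooth step is `C^∞` in `t`. [folklore] -/
theorem contDiff_smoothStep (c δ : ℝ) {n : ℕ∞} : ContDiff ℝ n (smoothStep c δ) := by
  unfold smoothStep
  exact Real.smoothTransition.contDiff.comp ((contDiff_id.sub contDiff_const).div_const δ)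

/-- The smooth step is continuous. [folklore] -/
theorem continuous_smoothStep (c δ : ℝ) : Continuous (smoothStep c δ) :=
  (contDiff_smoothStep c δ (n := 0)).continuous

/-! ### The staircase and the tracking path -/

/-- The **smooth staircase** through the values `x 0, x 1, …, x (J-1)` on the pieces of
`[0, T]` of length `T/J`: `x 0 + ∑_{i < J-1} (x (i+1) - x i) · step_{(i+1)T/J, δ}(t)`; it equals
`x j` on `[jT/J + δ, (j+1)T/J]`. [folklore] -/
def stairPath (T δ : ℝ) (J : ℕ) (x : ℕ → ℝ) (t : ℝ) : ℝ :=
  x 0 + ∑ i ∈ Finset.range (J - 1), (x (i + 1) - x i) * smoothStep ((i + 1 : ℕ) * T / J) δ t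

/-- The **tracking path**: the staircase in the middle, glued smoothly to the affine germ
`a₀ + a₁ t` on `[0, δ]` and to `b₀ + b₁ (t - T)` on `[T - δ, T]`. [folklore] -/
def trackPath (a₀ a₁ b₀ b₁ T δ : ℝ) (J : ℕ) (x : ℕ → ℝ) (t : ℝ) : ℝ :=
  (a₀ + a₁ * t) * (1 - smoothStep δ δ t) +
    smoothStep δ δ t * (1 - smoothStep (T - 2 * δ) δ t) * stairPath T δ J x t +
    smoothStep (T - 2 * δ) δ t * (b₀ + b₁ * (t - T))

/-- The staircase is `C^∞`. [folklore] -/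
theorem contDiff_stairPath (T δ : ℝ) (J : ℕ) (x : ℕ → ℝ) {n : ℕ∞} :
    ContDiff ℝ n (stairPath T δ J x) := by
  unfold stairPath
  refine contDiff_const.add (ContDiff.sum fun i _ => contDiff_const.mul (contDiff_smoothStep _ _))

/-- The staircase is continuous. [folklore] -/
theorem continuous_stairPath (T δ : ℝ) (J : ℕ) (x : ℕ → ℝ) : Continuous (stairPath T δ J x) :=
  (contDiff_stairPath T δ J x (n := 0)).continuous

/-- The tracking path is `C^∞`. [folklore] -/
theorem contDiff_trackPath (a₀ a₁ b₀ b₁ T δ : ℝ) (J : ℕ) (x : ℕ → ℝ) {n : ℕ∞} :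
    ContDiff ℝ n (trackPath a₀ a₁ b₀ b₁ T δ J x) := by
  unfold trackPath
  have h1 := contDiff_smoothStep δ δ (n := n)
  have h2 := contDiff_smoothStep (T - 2 * δ) δ (n := n)
  have h3 := contDiff_stairPath T δ J x (n := n)
  refine (((contDiff_const.add (contDiff_const.mul contDiff_id)).mul (contDiff_const.sub h1)).add
    ((h1.mul (contDiff_const.sub h2)).mul h3)).add (h2.mul (contDiff_const.add
      (contDiff_const.mul (contDiff_id.sub contDiff_const))))

/-- The tracking path is continuous. [folklore] -/
theorem continuous_trackPath (a₀ a₁ b₀ b₁ T δ : ℝ) (J : ℕ) (x : ℕ → ℝ) :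
    Continuous (trackPath a₀ a₁ b₀ b₁ T δ J x) :=
  (contDiff_trackPath a₀ a₁ b₀ b₁ T δ J x (n := 0)).continuous

/-- The staircase equals `x j` on the `j`-th piece past its window: `jT/J + δ ≤ t ≤ (j+1)T/J`,
`j ≤ J - 1`. [folklore] -/
theorem stairPath_eq {T δ : ℝ} (hT : 0 ≤ T) (hδ : 0 < δ) {J : ℕ} (hJ : 0 < J) (x : ℕ → ℝ) {j : ℕ}
    (hj : j ≤ J - 1) {t : ℝ} (ht1 : (j : ℝ) * T / J + δ ≤ t) (ht2 : t ≤ ((j : ℝ) + 1) * T / J) :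
    stairPath T δ J x t = x j := by
  unfold stairPath
  have hJ' : (0 : ℝ) < J := by exact_mod_cast hJ
  rw [← Finset.sum_range_add_sum_Ico _ hj]
  have h1 : ∀ i ∈ Finset.range j,
      (x (i + 1) - x i) * smoothStep ((i + 1 : ℕ) * T / J) δ t = x (i + 1) - x i := by
    intro i hi
    rw [Finset.mem_range] at hi
    rw [smoothStep_of_ge hδ, mul_one]
    have hi' : ((i + 1 : ℕ) : ℝ) ≤ j := by exact_mod_cast hi
    have : ((i + 1 : ℕ) : ℝ) * T / J ≤ (j : ℝ) * T / J :=
      div_le_div_of_nonneg_right (mul_le_mul_of_nonneg_right hi' hT) hJ'.le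
    linarith
  have h2 : ∀ i ∈ Finset.Ico j (J - 1),
      (x (i + 1) - x i) * smoothStep ((i + 1 : ℕ) * T / J) δ t = 0 := by
    intro i hi
    rw [Finset.mem_Ico] at hi
    rw [smoothStep_of_le hδ, mul_zero]
    have hi' : (j : ℝ) + 1 ≤ ((i + 1 : ℕ) : ℝ) := by push_cast; exact_mod_cast Nat.succ_le_succ hi.1
    exact ht2.trans (div_le_div_of_nonneg_right (mul_le_mul_of_nonneg_right hi' hT) hJ'.le)
  rw [Finset.sum_congr rfl h1, Finset.sum_congr rfl h2, Finset.sum_const_zero, add_zero,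
    Finset.sum_range_sub, add_sub_cancel]

/-- Near `0` (`t ≤ δ`, with `3δ ≤ T`) the tracking path is the affine germ `a₀ + a₁ t`.
[folklore] -/
theorem trackPath_of_le {a₀ a₁ b₀ b₁ T δ : ℝ} (hδ : 0 < δ) (h3 : 3 * δ ≤ T) (J : ℕ) (x : ℕ → ℝ)
    {t : ℝ} (ht : t ≤ δ) : trackPath a₀ a₁ b₀ b₁ T δ J x t = a₀ + a₁ * t := by
  unfold trackPath
  rw [smoothStep_of_le hδ ht, smoothStep_of_le hδ (by linarith)]
  ring

/-- Near `T` (`T - δ ≤ t`, with `3δ ≤ T`) the tracking path is the affine germ `b₀ + b₁ (t - T)`.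
[folklore] -/
theorem trackPath_of_ge {a₀ a₁ b₀ b₁ T δ : ℝ} (hδ : 0 < δ) (h3 : 3 * δ ≤ T) (J : ℕ) (x : ℕ → ℝ)
    {t : ℝ} (ht : T - δ ≤ t) : trackPath a₀ a₁ b₀ b₁ T δ J x t = b₀ + b₁ * (t - T) := by
  unfold trackPath
  rw [smoothStep_of_ge hδ (by linarith), smoothStep_of_ge hδ (by linarith)]
  ring

/-- In the middle (`2δ ≤ t ≤ T - 2δ`) the tracking path is the staircase. [folklore] -/
theorem trackPath_of_mem_middle {a₀ a₁ b₀ b₁ T δ : ℝ} (hδ : 0 < δ) (J : ℕ) (x : ℕ → ℝ) {t : ℝ}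
    (ht1 : 2 * δ ≤ t) (ht2 : t ≤ T - 2 * δ) :
    trackPath a₀ a₁ b₀ b₁ T δ J x t = stairPath T δ J x t := by
  unfold trackPath
  rw [smoothStep_of_ge hδ (by linarith), smoothStep_of_le hδ ht2]
  ring

/-- The values of the tracking path: `y 0 = a₀`. [folklore] -/
theorem trackPath_zero {a₀ a₁ b₀ b₁ T δ : ℝ} (hδ : 0 < δ) (h3 : 3 * δ ≤ T) (J : ℕ) (x : ℕ → ℝ) :
    trackPath a₀ a₁ b₀ b₁ T δ J x 0 = a₀ := by
  rw [trackPath_of_le hδ h3 J x hδ.le]; ring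

/-- `y T = b₀`. [folklore] -/
theorem trackPath_self {a₀ a₁ b₀ b₁ T δ : ℝ} (hδ : 0 < δ) (h3 : 3 * δ ≤ T) (J : ℕ) (x : ℕ → ℝ) :
    trackPath a₀ a₁ b₀ b₁ T δ J x T = b₀ := by
  rw [trackPath_of_ge hδ h3 J x (by linarith)]; ring

/-- `y' 0 = a₁`. [folklore] -/
theorem deriv_trackPath_zero {a₀ a₁ b₀ b₁ T δ : ℝ} (hδ : 0 < δ) (h3 : 3 * δ ≤ T) (J : ℕ)
    (x : ℕ → ℝ) : deriv (trackPath a₀ a₁ b₀ b₁ T δ J x) 0 = a₁ := by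
  have hev : trackPath a₀ a₁ b₀ b₁ T δ J x =ᶠ[𝓝 0] fun t => a₀ + a₁ * t :=
    Filter.eventuallyEq_of_mem (Iio_mem_nhds hδ) fun t ht => trackPath_of_le hδ h3 J x (le_of_lt ht)
  rw [hev.deriv_eq]
  have h : HasDerivAt (fun t => a₀ + a₁ * t) (a₁ * 1) 0 :=
    ((hasDerivAt_id (0 : ℝ)).const_mul a₁).const_add a₀
  rw [h.deriv, mul_one]

/-- `y' T = b₁`. [folklore] -/
theorem deriv_trackPath_self {a₀ a₁ b₀ b₁ T δ : ℝ} (hδ : 0 < δ) (h3 : 3 * δ ≤ T) (J : ℕ)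
    (x : ℕ → ℝ) : deriv (trackPath a₀ a₁ b₀ b₁ T δ J x) T = b₁ := by
  have hev : trackPath a₀ a₁ b₀ b₁ T δ J x =ᶠ[𝓝 T] fun t => b₀ + b₁ * (t - T) :=
    Filter.eventuallyEq_of_mem (Ioi_mem_nhds (by linarith : T - δ < T)) fun t ht =>
      trackPath_of_ge hδ h3 J x (le_of_lt ht)
  rw [hev.deriv_eq]
  have h : HasDerivAt (fun t => b₀ + b₁ * (t - T)) (b₁ * 1) T :=
    (((hasDerivAt_id T).sub_const T).const_mul b₁).const_add b₀
  rw [h.deriv, mul_one]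

/-- A bound for the staircase: `|stairPath t| ≤ |x 0| + ∑ |x (i+1) - x i|`. [folklore] -/
theorem abs_stairPath_le (T δ : ℝ) (J : ℕ) (x : ℕ → ℝ) (t : ℝ) :
    |stairPath T δ J x t| ≤ |x 0| + ∑ i ∈ Finset.range (J - 1), |x (i + 1) - x i| := by
  unfold stairPath
  refine (abs_add_le _ _).trans (add_le_add le_rfl ((Finset.abs_sum_le_sum_abs _ _).trans
    (Finset.sum_le_sum fun i _ => ?_)))
  rw [abs_mul]
  exact (mul_le_mul_of_nonneg_left (abs_smoothStep_le_one _ _ _) (abs_nonneg _)).trans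
    (by rw [mul_one])

/-- **A `δ`-independent bound for the tracking path on `[0, T]`**:
`|y t| ≤ |a₀| + |a₁| T + (|x 0| + ∑ |x (i+1) - x i|) + |b₀| + |b₁| T`. [folklore] -/
theorem abs_trackPath_le {a₀ a₁ b₀ b₁ T δ : ℝ} (J : ℕ) (x : ℕ → ℝ) {t : ℝ} (ht : t ∈ Icc 0 T) :
    |trackPath a₀ a₁ b₀ b₁ T δ J x t| ≤
      |a₀| + |a₁| * T + (|x 0| + ∑ i ∈ Finset.range (J - 1), |x (i + 1) - x i|) +
        (|b₀| + |b₁| * T) := by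
  unfold trackPath
  have hT : 0 ≤ T := ht.1.trans ht.2
  have hA : |(a₀ + a₁ * t) * (1 - smoothStep δ δ t)| ≤ |a₀| + |a₁| * T := by
    rw [abs_mul]
    refine (mul_le_mul_of_nonneg_left (abs_one_sub_smoothStep_le_one _ _ _) (abs_nonneg _)).trans ?_
    rw [mul_one]
    refine (abs_add_le _ _).trans (add_le_add le_rfl ?_)
    rw [abs_mul, abs_of_nonneg ht.1]
    exact mul_le_mul_of_nonneg_left ht.2 (abs_nonneg _)
  have hB : |smoothStep δ δ t * (1 - smoothStep (T - 2 * δ) δ t) * stairPath T δ J x t| ≤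
      |x 0| + ∑ i ∈ Finset.range (J - 1), |x (i + 1) - x i| := by
    rw [abs_mul, abs_mul]
    have h1 := abs_smoothStep_le_one δ δ t
    have h2 := abs_one_sub_smoothStep_le_one (T - 2 * δ) δ t
    have h3 := abs_stairPath_le T δ J x t
    have h12 : |smoothStep δ δ t| * |1 - smoothStep (T - 2 * δ) δ t| ≤ 1 := by
      nlinarith [abs_nonneg (smoothStep δ δ t), abs_nonneg (1 - smoothStep (T - 2 * δ) δ t)]
    calc |smoothStep δ δ t| * |1 - smoothStep (T - 2 * δ) δ t| * |stairPath T δ J x t|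
        ≤ 1 * |stairPath T δ J x t| := mul_le_mul_of_nonneg_right h12 (abs_nonneg _)
      _ ≤ _ := by rw [one_mul]; exact h3
  have hC : |smoothStep (T - 2 * δ) δ t * (b₀ + b₁ * (t - T))| ≤ |b₀| + |b₁| * T := by
    rw [abs_mul]
    refine (mul_le_mul_of_nonneg_right (abs_smoothStep_le_one _ _ _) (abs_nonneg _)).trans ?_
    rw [one_mul]
    refine (abs_add_le _ _).trans (add_le_add le_rfl ?_)
    rw [abs_mul]
    refine mul_le_mul_of_nonneg_left ?_ (abs_nonneg _)
    rw [abs_sub_comm, abs_of_nonneg (sub_nonneg.2 ht.2)]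
    linarith [ht.1]
  exact ((abs_add_le _ _).trans (add_le_add ((abs_add_le _ _).trans (add_le_add hA hB)) hC))

/-! ### The tracking theorem -/

/-- **Tracking a continuous force profile in `L¹` through a continuous surjection.** Let
`w : ℝ → ℝ` be continuous and onto, `g` continuous on `[0, T]` (`T > 0`), `η > 0`, and
`a₀, a₁, b₀, b₁ ∈ ℝ`. Then there is a `C²` (indeed `C^∞`) path `y` with `y(0) = a₀`,
`y'(0) = a₁`, `y(T) = b₀`, `y'(T) = b₁` and `∫₀ᵀ |w(y(t)) - g(t)| dt ≤ η`.

Proof: by uniform continuity pick `J` pieces on which `g` oscillates by `< η/(2T)`, preimages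
`x_j ∈ w⁻¹(g(jT/J))`, and the tracking path with window `δ`; off the windows (total length
`≤ (J+4)δ`) the path sits at `x_j` on the `j`-th piece, so the error is `< η/(2T)`; on them it
is at most `F = sup_{[-R,R]}|w| + sup_{[0,T]}|g|` with `R` independent of `δ`; take
`(J+4) δ F ≤ η/2`. [cite: ReyBelletThomas2002, Prop 4.2] -/
theorem exists_contDiff_forceTracking {w : ℝ → ℝ} (hw : Continuous w) (hws : Function.Surjective w)
    {T : ℝ} (hT : 0 < T) {g : ℝ → ℝ} (hg : ContinuousOn g (Icc 0 T)) (a₀ a₁ b₀ b₁ : ℝ) {η : ℝ}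
    (hη : 0 < η) :
    ∃ y : ℝ → ℝ, ContDiff ℝ 2 y ∧ y 0 = a₀ ∧ deriv y 0 = a₁ ∧ y T = b₀ ∧ deriv y T = b₁ ∧
      IntervalIntegrable (fun t => |w (y t) - g t|) volume 0 T ∧
      ∫ t in (0 : ℝ)..T, |w (y t) - g t| ≤ η := by
  -- uniform continuity of `g` on `[0, T]`: oscillation `< η/(2T)` on scale `τ`
  have hε2 : 0 < η / (2 * T) := by positivity
  obtain ⟨τ, hτ, hτg⟩ := Metric.uniformContinuousOn_iff.1
    (isCompact_Icc.uniformContinuousOn_of_continuous hg) (η / (2 * T)) hε2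
  -- number of pieces `J` with `T / J < τ`
  obtain ⟨J, hJτ, hJ⟩ : ∃ J : ℕ, T / J < τ ∧ 0 < J := by
    refine ⟨⌈T / τ⌉₊ + 1, ?_, Nat.succ_pos _⟩
    have h1 : T / τ < (⌈T / τ⌉₊ + 1 : ℕ) := by
      push_cast
      exact (Nat.le_ceil _).trans_lt (lt_add_one _)
    have h2 : (0 : ℝ) < (⌈T / τ⌉₊ + 1 : ℕ) := by positivity
    rw [div_lt_iff₀ h2]
    rw [div_lt_iff₀ hτ] at h1
    linarith
  have hJ' : (0 : ℝ) < J := by exact_mod_cast hJ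
  -- preimages of the node values
  have hx : ∀ j : ℕ, ∃ xj : ℝ, w xj = g (j * T / J) := fun j => hws _
  choose x hxw using hx
  -- the `δ`-independent radius and the error bound on the windows
  set R : ℝ := |a₀| + |a₁| * T + (|x 0| + ∑ i ∈ Finset.range (J - 1), |x (i + 1) - x i|) +
    (|b₀| + |b₁| * T) with hR
  obtain ⟨F₁, hF₁⟩ := (isCompact_Icc (a := -R) (b := R)).exists_bound_of_continuousOn
    hw.continuousOn
  obtain ⟨F₂, hF₂⟩ := (isCompact_Icc (a := (0 : ℝ)) (b := T)).exists_bound_of_continuousOn hg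
  set F : ℝ := max F₁ 0 + max F₂ 0 + 1 with hF
  have hF0 : 0 < F := by positivity
  -- the window
  set δ : ℝ := min (T / 4) (η / (2 * F * (J + 4))) with hδdef
  have hδ : 0 < δ := lt_min (by positivity) (by positivity)
  have hδT : 4 * δ ≤ T := by
    have : δ ≤ T / 4 := min_le_left _ _
    linarith
  have h3 : 3 * δ ≤ T := by linarith
  have hδF : F * ((J + 4) * δ) ≤ η / 2 := by
    have h1 : δ ≤ η / (2 * F * (J + 4)) := min_le_right _ _
    have h2 : 0 < 2 * F * (J + 4) := by positivity
    rw [le_div_iff₀ h2] at h1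
    nlinarith
  -- the path
  set y : ℝ → ℝ := trackPath a₀ a₁ b₀ b₁ T δ J x with hy
  have hyc : Continuous y := continuous_trackPath a₀ a₁ b₀ b₁ T δ J x
  refine ⟨y, contDiff_trackPath a₀ a₁ b₀ b₁ T δ J x (n := 2), trackPath_zero hδ h3 J x,
    deriv_trackPath_zero hδ h3 J x, trackPath_self hδ h3 J x, deriv_trackPath_self hδ h3 J x, ?_⟩
  -- the bad set (windows)
  set W : Set ℝ := (Ico 0 (2 * δ) ∪ Ioc (T - 2 * δ) T) ∪
    ⋃ j ∈ Finset.range J, Ico ((j : ℝ) * T / J) ((j : ℝ) * T / J + δ) with hW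
  have hWm : MeasurableSet W := by
    refine (measurableSet_Ico.union measurableSet_Ioc).union ?_
    exact Finset.measurableSet_biUnion _ fun j _ => measurableSet_Ico
  have hWsub : W ⊆ Icc 0 (T + δ) := by
    intro t ht
    simp only [hW, mem_union, mem_Ico, mem_Ioc, mem_iUnion, Finset.mem_range, exists_prop] at ht
    rcases ht with (⟨h1, h2⟩ | ⟨h1, h2⟩) | ⟨j, hj, h1, h2⟩
    · exact ⟨h1, by linarith⟩
    · exact ⟨by linarith, by linarith⟩
    · have hj0 : (0 : ℝ) ≤ j * T / J := by positivity
      have hjle : (j : ℝ) ≤ J := by exact_mod_cast hj.le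
      have hjT : (j : ℝ) * T / J ≤ T := by
        rw [div_le_iff₀ hJ']
        nlinarith
      exact ⟨hj0.trans h1, by linarith⟩
  have hWfin : volume W ≠ ⊤ :=
    (lt_of_le_of_lt (measure_mono hWsub) measure_Icc_lt_top).ne
  have hWvol : volume.real W ≤ (J + 4) * δ := by
    have h1 : volume.real (Ico 0 (2 * δ) ∪ Ioc (T - 2 * δ) T) ≤ 4 * δ := by
      refine (measureReal_union_le _ _).trans ?_
      rw [Real.volume_real_Ico_of_le (by linarith), Real.volume_real_Ioc_of_le (by linarith)]
      linarith
    have h2 : volume.real (⋃ j ∈ Finset.range J, Ico ((j : ℝ) * T / J) ((j : ℝ) * T / J + δ)) ≤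
        J * δ := by
      refine (measureReal_biUnion_finset_le _ _).trans ?_
      have : ∀ j ∈ Finset.range J,
          volume.real (Ico ((j : ℝ) * T / J) ((j : ℝ) * T / J + δ)) = δ := fun j _ => by
        rw [Real.volume_real_Ico_of_le (by linarith)]; ring
      rw [Finset.sum_congr rfl this, Finset.sum_const, Finset.card_range, nsmul_eq_mul]
    calc volume.real W ≤ volume.real (Ico 0 (2 * δ) ∪ Ioc (T - 2 * δ) T) +
          volume.real (⋃ j ∈ Finset.range J, Ico ((j : ℝ) * T / J) ((j : ℝ) * T / J + δ)) :=
          measureReal_union_le _ _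
      _ ≤ 4 * δ + J * δ := add_le_add h1 h2
      _ = (J + 4) * δ := by ring
  -- pointwise bound on `[0, T]`
  have hyR : ∀ t ∈ Icc 0 T, y t ∈ Icc (-R) R := fun t ht =>
    abs_le.1 (abs_trackPath_le J x ht)
  have hpt : ∀ t ∈ Icc 0 T, |w (y t) - g t| ≤ η / (2 * T) + F * W.indicator 1 t := by
    intro t ht
    by_cases htW : t ∈ W
    · rw [indicator_of_mem htW, Pi.one_apply, mul_one]
      have h1 : |w (y t)| ≤ max F₁ 0 :=
        (Real.norm_eq_abs _ ▸ hF₁ _ (hyR t ht)).trans (le_max_left _ _)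
      have h2 : |g t| ≤ max F₂ 0 := (Real.norm_eq_abs _ ▸ hF₂ t ht).trans (le_max_left _ _)
      calc |w (y t) - g t| ≤ |w (y t)| + |g t| := abs_sub _ _
        _ ≤ max F₁ 0 + max F₂ 0 := add_le_add h1 h2
        _ ≤ F := by rw [hF]; linarith
        _ ≤ η / (2 * T) + F := le_add_of_nonneg_left hε2.le
    · rw [indicator_of_notMem htW, mul_zero, add_zero]
      -- `t` is in the middle and past the window of its piece
      have htW' := htW
      simp only [hW, mem_union, mem_Ico, mem_Ioc, mem_iUnion, Finset.mem_range, not_or,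
        not_exists, not_and, not_lt, not_le, exists_prop] at htW'
      obtain ⟨⟨hA, hB⟩, hC⟩ := htW'
      have ht1 : 2 * δ ≤ t := hA ht.1
      have ht2 : t ≤ T - 2 * δ := by
        by_contra h
        exact absurd ht.2 (not_le.2 (hB (not_le.1 h)))
      -- the piece containing `t`
      have ht0 : 0 ≤ t := ht.1
      set j : ℕ := ⌊t * J / T⌋₊ with hjdef
      have htJ0 : 0 ≤ t * J / T := by positivity
      have hjle : (j : ℝ) ≤ t * J / T := Nat.floor_le htJ0
      have hjlt : t * J / T < j + 1 := Nat.lt_floor_add_one _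
      have hjJ : j < J := by
        rw [hjdef, Nat.floor_lt htJ0, div_lt_iff₀ hT]
        have : t < T := by linarith
        nlinarith
      have hj' : j ≤ J - 1 := Nat.le_sub_one_of_lt hjJ
      have htj1 : (j : ℝ) * T / J ≤ t := by
        rw [div_le_iff₀ hJ']
        rw [le_div_iff₀ hT] at hjle
        linarith
      have htj2 : t ≤ ((j : ℝ) + 1) * T / J := by
        rw [le_div_iff₀ hJ']
        rw [div_lt_iff₀ hT] at hjlt
        linarith
      have htj3 : (j : ℝ) * T / J + δ ≤ t := hC j hjJ htj1
      have hyt : y t = x j := by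
        rw [hy, trackPath_of_mem_middle hδ J x ht1 ht2, stairPath_eq hT.le hδ hJ x hj' htj3 htj2]
      rw [hyt, hxw j]
      -- oscillation of `g`
      have hmem : (j : ℝ) * T / J ∈ Icc 0 T := ⟨by positivity, htj1.trans ht.2⟩
      have hdist : dist ((j : ℝ) * T / J) t < τ := by
        rw [dist_comm, Real.dist_eq, abs_of_nonneg (sub_nonneg.2 htj1)]
        have : t - (j : ℝ) * T / J ≤ T / J := by
          rw [le_div_iff₀ hJ', sub_mul, div_mul_cancel₀ _ hJ'.ne']
          rw [le_div_iff₀ hJ'] at htj2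
          linarith
        exact this.trans_lt hJτ
      have h := hτg _ hmem t ht hdist
      rw [Real.dist_eq] at h
      exact h.le
  -- integrate
  have hint : IntervalIntegrable (fun t => |w (y t) - g t|) volume 0 T := by
    refine ContinuousOn.intervalIntegrable_of_Icc hT.le ?_
    exact continuous_abs.comp_continuousOn (((hw.comp hyc).continuousOn).sub hg)
  have hWint : Integrable (W.indicator (1 : ℝ → ℝ)) volume :=
    (integrable_indicator_iff hWm).2 (integrableOn_const hWfin)
  have hint1 : IntervalIntegrable (fun t => W.indicator (1 : ℝ → ℝ) t) volume 0 T :=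
    hWint.intervalIntegrable
  have hint2 : IntervalIntegrable (fun t => η / (2 * T) + F * W.indicator 1 t) volume 0 T :=
    intervalIntegrable_const.add (hint1.const_mul F)
  have hind : ∫ t in (0 : ℝ)..T, W.indicator (1 : ℝ → ℝ) t ≤ (J + 4) * δ := by
    rw [intervalIntegral.integral_of_le hT.le]
    calc ∫ t in Ioc 0 T, W.indicator (1 : ℝ → ℝ) t ≤ ∫ t, W.indicator (1 : ℝ → ℝ) t :=
          setIntegral_le_integral hWint (Eventually.of_forall fun t =>
            Set.indicator_nonneg (fun _ _ => zero_le_one) t)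
      _ = volume.real W := integral_indicator_one hWm
      _ ≤ (J + 4) * δ := hWvol
  refine ⟨hint, ?_⟩
  calc ∫ t in (0 : ℝ)..T, |w (y t) - g t|
      ≤ ∫ t in (0 : ℝ)..T, (η / (2 * T) + F * W.indicator 1 t) :=
        intervalIntegral.integral_mono_on hT.le hint hint2 hpt
    _ = (T - 0) * (η / (2 * T)) + F * ∫ t in (0 : ℝ)..T, W.indicator (1 : ℝ → ℝ) t := by
        rw [intervalIntegral.integral_add intervalIntegrable_const (hint1.const_mul F),
          intervalIntegral.integral_const, smul_eq_mul, intervalIntegral.integral_const_mul]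
    _ ≤ η / 2 + F * ((J + 4) * δ) := by
        refine add_le_add (le_of_eq ?_) (mul_le_mul_of_nonneg_left hind hF0.le)
        field_simp
        ring
    _ ≤ η := by linarith

/-- The `sup`-of-primitive form of the tracking theorem: the same path satisfies
`|∫₀ᵗ (w(y(s)) - g(s)) ds| ≤ η` for every `t ∈ [0, T]` (the form consumed by Grönwall estimates
for driven oscillators, whose momentum sees the force through its primitive). [folklore] -/
theorem exists_contDiff_forceTracking' {w : ℝ → ℝ} (hw : Continuous w) (hws : Function.Surjective w)
    {T : ℝ} (hT : 0 < T) {g : ℝ → ℝ} (hg : ContinuousOn g (Icc 0 T)) (a₀ a₁ b₀ b₁ : ℝ) {η : ℝ}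
    (hη : 0 < η) :
    ∃ y : ℝ → ℝ, ContDiff ℝ 2 y ∧ y 0 = a₀ ∧ deriv y 0 = a₁ ∧ y T = b₀ ∧ deriv y T = b₁ ∧
      ∀ t ∈ Icc 0 T, |∫ s in (0 : ℝ)..t, (w (y s) - g s)| ≤ η := by
  obtain ⟨y, hy, h0, h0', hT0, hT', hint, hle⟩ :=
    exists_contDiff_forceTracking hw hws hT hg a₀ a₁ b₀ b₁ hη
  refine ⟨y, hy, h0, h0', hT0, hT', fun t ht => ?_⟩
  have hint' : IntervalIntegrable (fun s => |w (y s) - g s|) volume 0 t :=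
    hint.mono_set (by rw [uIcc_of_le hT.le, uIcc_of_le ht.1]; exact Icc_subset_Icc le_rfl ht.2)
  calc |∫ s in (0 : ℝ)..t, (w (y s) - g s)| ≤ ∫ s in (0 : ℝ)..t, |w (y s) - g s| :=
        intervalIntegral.abs_integral_le_integral_abs ht.1
    _ ≤ ∫ s in (0 : ℝ)..T, |w (y s) - g s| := by
        refine intervalIntegral.integral_mono_interval le_rfl ht.1 ht.2 ?_ hint
        exact Eventually.of_forall fun s => abs_nonneg _
    _ ≤ η := hle

end Literature.Analysis.ODE

end
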